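import Summits.RiemannHypothesis.RiemannHypothesis.Theses.GapsEvoDoors

/-!
# GapsEvoDoors — `Assembly` (item stmt-RiemannHypothesis-22424): the pointwise assembly

Route `GapsEvoDoors`, assembly item: for every `φ ≤ 0.50884` and `Δ ≥ 1`,
`(Inoue Thm 2 → RH → μ ≤ φ) → (fragment on (1, Δ] → RH → close pair below 2001 → CI (1.22)) →
DoorsResidual → RH`. The two hypotheses pack into the route's rungs: `InOptRung` by monotonicity of
`μ ≤ ·` (tree `ZetaGapLiminfLe.mono`) and `FragmentToCI` by packing the `∃ Δ`; the declared
residual `DoorsResidual := InOptRung → FragmentToCI → RH` then yields the summit statement. This is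
bookkeeping only (the residual is summit-strength by design and never staffed). RH-sentence (c):
a record INSIDE route GapsEvoDoors — toward RiemannHypothesis: 0. Nothing here bears on the truth
of RH.
-/

noncomputable section

open Literature.NumberTheory.LFunctions

set_option linter.dupNamespace false  -- the mandated namespace repeats `RiemannHypothesis`

namespace Summit.RiemannHypothesis.RiemannHypothesis.Theorems.GapsEvoDoorsAssembly

open Summit.RiemannHypothesis.RiemannHypothesis.Theses.GapsEvoDoors

/-- **`Assembly` holds** (item stmt-RiemannHypothesis-22424 of route GapsEvoDoors): the pointwise
hypotheses at level `φ ≤ 0.50884` and window `Δ ≥ 1` give `InOptRung` (by `ZetaGapLiminfLe.mono`)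
and `FragmentToCI` (pack the `∃`), and `DoorsResidual` concludes. Toward RiemannHypothesis: 0 (the
residual is the summit-strength hypothesis). -/
theorem Assembly_holds : Summit.RiemannHypothesis.RiemannHypothesis.Theses.GapsEvoDoors.Assembly := by
  unfold Summit.RiemannHypothesis.RiemannHypothesis.Theses.GapsEvoDoors.Assembly
  intro φ Δ hφ hIn hΔ hFrag hR
  refine hR (fun h2 hRH ↦ (hIn h2 hRH).mono hφ) ⟨Δ, hΔ, hFrag⟩

end Summit.RiemannHypothesis.RiemannHypothesis.Theorems.GapsEvoDoorsAssembly

end
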